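import Summits.ValiantsHypothesis.ValiantsHypothesis.Theses.DivisionGap
import Literature.Barriers.ValiantsHypothesis.MonotoneGapProofs
import Literature.Barriers.ValiantsHypothesis.MonotoneGapUpper
import Literature.Computability.AlgebraicComplexity.ArithCircuitProofs

/-!
# `ZeroOneTransfer` — negative lemma: the cofactor `h` (division) IS LOAD-BEARING

Crux `stmt-ValiantsHypothesis-5066` (`Theses.DivisionGap.ZeroOneTransfer`, route DivisionGap).
Standing disprover (cdisprove), `Cruxes/ZeroOneTransfer/Disproof.lean` §(B).

The natural strengthening of the crux that freezes the cofactor to `h = 1` — "every p-family over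
`ℝ≥0` with 0/1 coefficients whose complexification is in `VP_ℂ` has quasi-polynomially bounded
MONOTONE complexity (the tree's fan-in-two `complexity` over the semiring `ℝ≥0`)" — is FALSE
(`zeroOneTransfer_noDivision_false`).  Witness: Jerrum–Snir's directed spanning-tree polynomial
`stPoly` (coefficients `0/1`, in `VP` over every field by the matrix-tree theorem —
`isVPFamily_stPoly_holds`), whose monotone complexity is `≥ 2^{N/20}` for `N ≥ 60`
(`complexity_stPoly_ge`: the tree's `JerrumSnir1982_spanningTree_holds`, stated there only for
Jerrum–Snir's PLAIN circuits, re-run for weighted fan-in-two circuits — its decomposition engine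
`exists_decomposition` never used plainness).  Hence only monotone lower bounds that survive an
arbitrary nonzero cofactor `h` can refute the crux; this witness itself collapses with division
(FominGrigorievKoshevoy2014 Thm 7.2, route item `StDivisionEasy`).
-/

namespace Summit.ValiantsHypothesis.ValiantsHypothesis.Theorems.ZeroOneTransfer.Negative

open Literature.Computability.AlgebraicComplexity Literature.Barriers.ValiantsHypothesis
open MvPolynomial Finset Filter
open scoped NNReal

noncomputable section

/-- **Jerrum–Snir for weighted circuits.**  Every fan-in-two circuit over `ℝ≥0` (weighted sum
gates allowed) computing `ST_N`, `N ≥ 60`, has at least `2^{N/20}` product gates; the proof is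
the tree's `JerrumSnir1982_spanningTree_holds` verbatim with `exists_decomposition` in place of
its plain-circuit corollary. [cite: JerrumSnir1982, §4.5 and §5.1] -/
theorem two_rpow_le_prodCount {N : ℕ} (hN : 60 ≤ N)
    {P : ArithCircuit ℝ≥0 (Fin N × Option (Fin N))} (hP2 : P.IsFanInTwo)
    (hP : P.Computes (stPoly ℝ≥0 N)) : (2 : ℝ) ^ ((1 / 20 : ℝ) * N) ≤ prodCount P := by
  have heval : P.eval = stPoly ℝ≥0 N := hP
  -- (1) the balanced decomposition with `m = ⌊N/3⌋`
  have hm1 : 1 ≤ N / 3 := by omega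
  have hmN : N / 3 < N := by omega
  obtain ⟨L, hLlen, hLsum, hLdeg⟩ :=
    Literature.Barriers.ValiantsHypothesis.exists_decomposition hm1 hmN _ P le_rfl hP2
      (by rw [heval]; exact stPoly_isHomogeneous ℝ≥0 N)
  rw [heval] at hLsum
  -- (2) every product has few monomials
  have hN1 : 1 ≤ N := by omega
  have hNpos : (0 : ℝ) < N := by exact_mod_cast hN1
  set r : ℝ := (9 + 8 * N) / 9 with hr
  have hrpos : 0 < r := by positivity
  have hterm : ∀ ab ∈ L, ((ab.1 * ab.2).support.card : ℝ) ≤ r ^ N := by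
    intro ab hab
    by_cases hb : ab.2 = 0
    · simp only [hb, mul_zero, support_zero, card_empty, Nat.cast_zero]
      positivity
    have hdeg := hLdeg ab hab
    have ha : ab.1 ≠ 0 := by
      intro ha
      rw [ha, totalDegree_zero] at hdeg
      omega
    have hsub : (ab.1 * ab.2).support ⊆ (stPoly ℝ≥0 N).support := by
      obtain ⟨q, hq⟩ := exists_sum_eq_add_of_mem (fun ab : MvPolynomial _ ℝ≥0 × _ => ab.1 * ab.2)
        L ab hab
      exact support_subset_of_eq_add (hLsum.trans hq)
    obtain ⟨hkN, hcard⟩ := card_support_mul_le hN1 hsub ha hb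
    refine hcard.trans (pow_le_pow_left₀ (by positivity) ?_ N)
    have hT := nine_mul_bound_le hdeg.1 hdeg.2
    rw [div_le_iff₀ hNpos, hr]
    have hT' : (9 : ℝ) * ((N + ab.1.totalDegree ^ 2 + (N - ab.1.totalDegree) ^ 2 +
        ab.1.totalDegree * (N - ab.1.totalDegree) : ℕ) : ℝ) ≤ 9 * N + 8 * (N : ℝ) ^ 2 := by
      exact_mod_cast hT
    nlinarith [hT']
  -- (3) counting monomials: `(N+1)^(N-1) ≤ prodCount P · r^N`
  have hcount : ((N : ℝ) + 1) ^ (N - 1) ≤ prodCount P * r ^ N := by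
    have h1 := card_support_sum_le L (r ^ N) hterm
    rw [← hLsum, card_support_stPoly_eq] at h1
    push_cast at h1
    refine h1.trans ?_
    gcongr
  -- (4) arithmetic: `2^(N/20) (N+1) r^N ≤ (N+1)^N`
  have hq : (28 / 25 : ℝ) ≤ 9 * ((N : ℝ) + 1) / (9 + 8 * N) := ratio_ge (by omega)
  have hqr : 9 * ((N : ℝ) + 1) / (9 + 8 * N) * r = N + 1 := by
    rw [hr]; field_simp
  have hkey : (2 : ℝ) ^ ((1 / 20 : ℝ) * N) * ((N : ℝ) + 1) * r ^ N ≤ ((N : ℝ) + 1) ^ N := by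
    calc (2 : ℝ) ^ ((1 / 20 : ℝ) * N) * ((N : ℝ) + 1) * r ^ N
        ≤ (26 / 25 : ℝ) ^ N * (14 / 13 : ℝ) ^ N * r ^ N := by
          gcongr
          · exact two_rpow_div_twenty_le N
          · exact succ_le_pow_of_sixty_le hN
      _ = (28 / 25 : ℝ) ^ N * r ^ N := by rw [← mul_pow]; norm_num
      _ ≤ (9 * ((N : ℝ) + 1) / (9 + 8 * N)) ^ N * r ^ N := by gcongr
      _ = ((N : ℝ) + 1) ^ N := by rw [← mul_pow, hqr]
  have hpow : ((N : ℝ) + 1) ^ N = ((N : ℝ) + 1) * ((N : ℝ) + 1) ^ (N - 1) := by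
    rw [← pow_succ']; congr 1; omega
  rw [hpow] at hkey
  have hN1' : (0 : ℝ) < (N : ℝ) + 1 := by positivity
  have h5 : (2 : ℝ) ^ ((1 / 20 : ℝ) * N) * r ^ N ≤ ((N : ℝ) + 1) ^ (N - 1) := by
    have := hkey
    rw [mul_comm ((2 : ℝ) ^ _) ((N : ℝ) + 1), mul_assoc] at this
    exact le_of_mul_le_mul_left this hN1'
  have h6 : (2 : ℝ) ^ ((1 / 20 : ℝ) * N) * r ^ N ≤ prodCount P * r ^ N := h5.trans hcount
  exact le_of_mul_le_mul_right h6 (pow_pos hrpos N)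

/-- **Monotone complexity of `ST` in the tree's model**: `2^{N/20} ≤ L_{ℝ≥0}(ST_N)` for `N ≥ 60`
(weighted fan-in-two circuits over `ℝ≥0`). [cite: JerrumSnir1982, §4.5 and §5.1] -/
theorem complexity_stPoly_ge {N : ℕ} (hN : 60 ≤ N) :
    (2 : ℝ) ^ ((1 / 20 : ℝ) * N) ≤ complexity (stPoly ℝ≥0 N) := by
  obtain ⟨P, h2, hP, hsize⟩ := ArithCircuit.exists_computes_size_eq_complexity (stPoly ℝ≥0 N)
  calc (2 : ℝ) ^ ((1 / 20 : ℝ) * N) ≤ prodCount P := two_rpow_le_prodCount hN h2 hP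
    _ ≤ (P.size : ℝ) := by exact_mod_cast prodCount_le_size P
    _ = complexity (stPoly ℝ≥0 N) := by rw [hsize]

/-- The quasi-polynomial bound loses to `2^{N/20}`: for every `c` there is `N ≥ 60` with
`20 (log₂ N + c)^c < N` (take `N = 2^L`, `L` large: `L^{c+1} ≤ 2^L`). [folklore] -/
theorem exists_qp_lt (c : ℕ) : ∃ N : ℕ, 60 ≤ N ∧ 20 * (Nat.log 2 N + c) ^ c < N := by
  have ht := tendsto_pow_const_div_const_pow_of_one_lt (c + 1) (one_lt_two (α := ℝ))
  have hev : ∀ᶠ m : ℕ in atTop, (m : ℝ) ^ (c + 1) / 2 ^ m ≤ 1 :=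
    ht.eventually (ge_mem_nhds one_pos)
  obtain ⟨N₀, hN₀⟩ := eventually_atTop.1 hev
  set L : ℕ := max (max N₀ (20 * 2 ^ c + 1)) (max c 6) with hLdef
  have hL0 : N₀ ≤ L := le_trans (le_max_left _ _) (le_max_left _ _)
  have hL1 : 20 * 2 ^ c + 1 ≤ L := le_trans (le_max_right _ _) (le_max_left _ _)
  have hLc : c ≤ L := le_trans (le_max_left _ _) (le_max_right _ _)
  have hL6 : 6 ≤ L := le_trans (le_max_right _ _) (le_max_right _ _)
  refine ⟨2 ^ L, ?_, ?_⟩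
  · calc 60 ≤ 2 ^ 6 := by norm_num
      _ ≤ 2 ^ L := Nat.pow_le_pow_right two_pos hL6
  rw [Nat.log_pow one_lt_two]
  have h1 : (L : ℝ) ^ (c + 1) / 2 ^ L ≤ 1 := hN₀ L hL0
  rw [div_le_one (by positivity)] at h1
  have h2 : L ^ (c + 1) ≤ 2 ^ L := by exact_mod_cast h1
  have hpos : 1 ≤ L ^ c := Nat.one_le_pow _ _ (by omega)
  calc 20 * (L + c) ^ c ≤ 20 * (2 * L) ^ c :=
        Nat.mul_le_mul_left _ (Nat.pow_le_pow_left (by omega) c)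
    _ = 20 * 2 ^ c * L ^ c := by rw [mul_pow]; ring
    _ < (20 * 2 ^ c + 1) * L ^ c := by nlinarith
    _ ≤ L * L ^ c := Nat.mul_le_mul_right _ hL1
    _ = L ^ (c + 1) := by ring
    _ ≤ 2 ^ L := h2

/-- `ST` over `ℝ≥0` has coefficients in `{0, 1}`. [cite: JerrumSnir1982, §4.5] -/
theorem coeff_stPoly_zero_or_one (N : ℕ) (m : (Fin N × Option (Fin N)) →₀ ℕ) :
    coeff m (stPoly ℝ≥0 N) = 0 ∨ coeff m (stPoly ℝ≥0 N) = 1 := by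
  rw [coeff_stPoly]
  split_ifs <;> simp

/-- **`ZeroOneTransfer` with `h := 1` (no division) is false.**  The spanning tree family `ST_N`
has 0/1 coefficients, its complexification is in `VP_ℂ` (`isVPFamily_stPoly_holds`), and its
monotone complexity is `≥ 2^{N/20}` (`complexity_stPoly_ge`), which beats `2^{(log₂ N + c)^c}` at
the `N` of `exists_qp_lt c`.  Hence the cofactor `h` in the crux is load-bearing: refuting
`ZeroOneTransfer` needs a monotone lower bound robust to an arbitrary nonzero cofactor.
[cite: JerrumSnir1982, §4.5 and §5.1] -/
theorem zeroOneTransfer_noDivision_false :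
    ¬ (∀ (σ : ℕ → Type) [∀ n, Fintype (σ n)] (f : ∀ n, MvPolynomial (σ n) ℝ≥0),
        (∀ n m, MvPolynomial.coeff m (f n) = 0 ∨ MvPolynomial.coeff m (f n) = 1) →
        Literature.Computability.AlgebraicComplexity.IsVPFamily (k := ℂ)
          (fun n => MvPolynomial.map (Complex.ofRealHom.comp NNReal.toRealHom) (f n)) →
        ∃ c : ℕ, ∀ n, Literature.Computability.AlgebraicComplexity.complexity (f n) ≤
          2 ^ ((Nat.log 2 n + c) ^ c)) := by
  intro H
  have hmap : (fun N => map (Complex.ofRealHom.comp NNReal.toRealHom) (stPoly ℝ≥0 N)) =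
      fun N => stPoly ℂ N := by
    funext N; exact map_stPoly _ N
  have hVP : IsVPFamily (k := ℂ)
      (fun N => map (Complex.ofRealHom.comp NNReal.toRealHom) (stPoly ℝ≥0 N)) := by
    rw [hmap]; exact isVPFamily_stPoly_holds ℂ
  obtain ⟨c, hc⟩ := H (fun N => Fin N × Option (Fin N)) (fun N => stPoly ℝ≥0 N)
    coeff_stPoly_zero_or_one hVP
  obtain ⟨N, hN, hlt⟩ := exists_qp_lt c
  have hlow := complexity_stPoly_ge hN
  have hcN := hc N
  generalize (Nat.log 2 N + c) ^ c = E at hlt hcN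
  have hup : (complexity (stPoly ℝ≥0 N) : ℝ) ≤ (2 : ℝ) ^ ((E : ℕ) : ℝ) := by
    rw [Real.rpow_natCast]; exact_mod_cast hcN
  have h1 : (1 / 20 : ℝ) * N ≤ ((E : ℕ) : ℝ) :=
    (Real.rpow_le_rpow_left_iff one_lt_two).mp (hlow.trans hup)
  have h2 : (N : ℝ) ≤ 20 * ((E : ℕ) : ℝ) := by linarith
  have h3 : N ≤ 20 * E := by exact_mod_cast h2
  omega

end

end Summit.ValiantsHypothesis.ValiantsHypothesis.Theorems.ZeroOneTransfer.Negative
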